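import Summits.Schanuel.Schanuel.Theorems.RootDecomp1HMirrorCore

/-!
# RootDecomp1HMirror — part 2/3 (the MIRROR): obliqueness, σ-stable hyperplanes, the ladder `T_k`, the sibling theorem `T₁` (§2) + the unconditional rungs at rank two (§4)

Continuation of `RootDecomp1HMirrorCore` (lens 5 gen 12 node «Mirror» = ROUND 12 of route-Schanuel-RootDecomp1H, a THEOREM ROUND — critic g5 14:49:48Z PATH T;
three-part split of the 760-line port under the 400-line rule, same namespace `Summit.Schanuel.Schanuel.Theorems.RootDecomp1HMirror`; `--supports stmt-Schanuel-27286`).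
Sorry-free; standard axioms. Nothing here proves Schanuel; rung 0.
-/

noncomputable section

set_option linter.dupNamespace false

namespace Summit.Schanuel.Schanuel.Theorems.RootDecomp1HMirror

open Complex Set
open Literature.NumberTheory.Transcendental
open Literature.NumberTheory.Transcendental.GammaField
open Summit.Schanuel.Schanuel.Theses.RootDecomp1H

variable {n : ℕ}

/-! ## §2 The MIRROR: obliqueness, `σ`-stable hyperplanes, the ladder `T_k`, the sibling theorem `T₁` -/

/-- Schanuel at the `σ`-STABLE `ℚ`-free `m`-tuples (span closed under complex conjugation). -/
def ConjSchanuelRank (m : ℕ) : Prop :=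
  ∀ x : Fin m → ℂ, LinearIndependent ℚ x → (∀ j, (starRingEnd ℂ) (x j) ∈ Submodule.span ℚ (range x)) →
    (m : Cardinal) ≤ Algebra.trdeg ℚ ↥(IntermediateField.adjoin ℚ (range x ∪ range (cexp ∘ x)))

/-- Schanuel at rank `m` implies the σ-stable-tuples version at rank `m`. -/
theorem conjSchanuelRank_of_schanuelRank {m : ℕ} (h : SchanuelRank m) : ConjSchanuelRank m :=
  fun x hx _ => h x hx

/-- `ConjSchanuelRank m` in subspace form. -/
theorem conjSchanuelRank_iff_delta (m : ℕ) : ConjSchanuelRank m ↔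
    ∀ Λ : Submodule ℚ ℂ, FiniteDimensional ℚ Λ → Module.finrank ℚ Λ = m → Λ.map conjQ ≤ Λ → 0 ≤ δ Λ := by
  constructor
  · intro h Λ _ hΛ hσ
    obtain ⟨x, hx, rfl⟩ := exists_basis_tuple Λ hΛ
    exact (le_trdeg_iff_delta_nonneg hx).1 (h x hx ((map_conjQ_span_le_iff x).1 hσ))
  · intro h x hx hcs
    haveI : FiniteDimensional ℚ ↥(Submodule.span ℚ (range x)) := FiniteDimensional.span_of_finite ℚ (finite_range x)
    exact (le_trdeg_iff_delta_nonneg hx).2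
      (h _ inferInstance (by rw [finrank_span_eq_card hx, Fintype.card_fin]) ((map_conjQ_span_le_iff x).2 hcs))

/-- **`σ`-stable hyperplanes exist**: a `σ`-stable subspace `W` of dimension `N + 1` contains a `σ`-stable subspace of
dimension `N` (kernel of a `σ`-(anti)symmetrised functional not vanishing at a real or imaginary vector of `W`). -/
theorem exists_conjStable_hyperplane (W : Submodule ℚ ℂ) [FiniteDimensional ℚ W] (hW : W.map conjQ ≤ W)
    {N : ℕ} (hN : Module.finrank ℚ W = N + 1) :
    ∃ P : Submodule ℚ ℂ, P ≤ W ∧ P.map conjQ ≤ P ∧ Module.finrank ℚ P = N := by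
  classical
  have hW' : ∀ w ∈ W, conjQ w ∈ W := fun w hw => hW (Submodule.mem_map_of_mem hw)
  let σW : W →ₗ[ℚ] W := conjQ.restrict hW'
  have σW_coe : ∀ w : W, ((σW w : W) : ℂ) = (starRingEnd ℂ) w := fun w => rfl
  have σW_σW : ∀ w : W, σW (σW w) = w := fun w => by
    apply Subtype.ext; rw [σW_coe, σW_coe]; simp
  -- a nonzero `u ∈ W` with `σ u = s • u`, `s = ±1`
  haveI : Nontrivial W := Module.nontrivial_of_finrank_pos (R := ℚ) (by rw [hN]; exact Nat.succ_pos N)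
  obtain ⟨w₀, hw₀⟩ := exists_ne (0 : W)
  obtain ⟨u, s, hu0, hsu, hs⟩ : ∃ (u : W) (s : ℚ), u ≠ 0 ∧ σW u = s • u ∧ s * s = 1 := by
    by_cases h : w₀ + σW w₀ = 0
    · refine ⟨w₀ - σW w₀, -1, ?_, ?_, by norm_num⟩
      · intro h'
        apply hw₀
        have h2 : (2 : ℚ) • w₀ = 0 := by
          rw [two_smul]
          calc w₀ + w₀ = (w₀ + σW w₀) + (w₀ - σW w₀) := by abel
            _ = 0 := by rw [h, h', add_zero]
        exact (smul_eq_zero.1 h2).resolve_left (by norm_num)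
      · rw [map_sub, σW_σW, neg_smul, one_smul, neg_sub]
    · exact ⟨w₀ + σW w₀, 1, h, by rw [map_add, σW_σW, one_smul, add_comm], by norm_num⟩
  -- a functional not vanishing at `u`, (anti)symmetrised
  obtain ⟨φ, hφ⟩ : ∃ φ : Module.Dual ℚ W, φ u ≠ 0 := by
    by_contra h
    push Not at h
    exact hu0 ((Module.forall_dual_apply_eq_zero_iff ℚ u).1 h)
  let ψ : Module.Dual ℚ W := φ + s • (φ.comp σW)
  have hψu : ψ u ≠ 0 := by
    have : ψ u = 2 * φ u := by
      simp only [ψ, LinearMap.add_apply, LinearMap.smul_apply, LinearMap.comp_apply, hsu, map_smul, smul_eq_mul]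
      rw [← mul_assoc, hs, one_mul, two_mul]
    rw [this]; exact mul_ne_zero two_ne_zero hφ
  have hψσ : ∀ v, ψ (σW v) = s * ψ v := by
    intro v
    simp only [ψ, LinearMap.add_apply, LinearMap.smul_apply, LinearMap.comp_apply, σW_σW, smul_eq_mul]
    rw [mul_add, ← mul_assoc, hs, one_mul, add_comm]
  have hψ0 : ψ ≠ 0 := fun h => hψu (by rw [h]; rfl)
  -- `P :=` the kernel of `ψ`, pushed into `ℂ`
  refine ⟨(LinearMap.ker ψ).map W.subtype, Submodule.map_subtype_le W _, ?_, ?_⟩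
  · rw [Submodule.map_le_iff_le_comap]
    rintro _ ⟨v, hv, rfl⟩
    refine ⟨σW v, ?_, rfl⟩
    show σW v ∈ LinearMap.ker ψ
    rw [LinearMap.mem_ker, hψσ, LinearMap.mem_ker.1 (by exact hv), mul_zero]
  · rw [(Submodule.equivMapOfInjective W.subtype W.injective_subtype (LinearMap.ker ψ)).finrank_eq.symm]
    have := Module.Dual.finrank_ker_add_one_of_ne_zero hψ0
    omega

/-- **THE LADDER `T_k`.**  `LowerRanks n ∧ ConjSchanuelRank n ∧ ConjSchanuelRank (n+1) ∧ … ∧ ConjSchanuelRank (n+k−1)`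
imply Schanuel at every `ℚ`-free `n`-tuple `x` of OBLIQUENESS `≤ k`, i.e. with `dim_ℚ (span x + σ span x) ≤ n + k`.
(`σ`-symmetrisation: `δ(V + σV) + δ(V ∩ σV) ≤ 2 δ(V)`; the small space is charged to the lower ranks, the big one — through a
`σ`-stable hyperplane, along which `δ` drops by at most one — to `ConjSchanuelRank (dim − 1)`.) -/
theorem ladder (hlow : ∀ m < n, SchanuelRank m) {k : ℕ} (hn : ConjSchanuelRank n)
    (hup : ∀ m, n < m → m < n + k → ConjSchanuelRank m)
    {x : Fin n → ℂ} (hx : LinearIndependent ℚ x)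
    (hob : Module.finrank ℚ ↥(Submodule.span ℚ (range x) ⊔ (Submodule.span ℚ (range x)).map conjQ) ≤ n + k) :
    (n : Cardinal) ≤ Algebra.trdeg ℚ ↥(IntermediateField.adjoin ℚ (range x ∪ range (cexp ∘ x))) := by
  classical
  set V := Submodule.span ℚ (range x) with hV
  haveI : FiniteDimensional ℚ V := FiniteDimensional.span_of_finite ℚ (finite_range x)
  have hVn : Module.finrank ℚ V = n := by rw [hV, finrank_span_eq_card hx, Fintype.card_fin]
  rw [le_trdeg_iff_delta_nonneg hx]
  by_contra hneg
  push Not at hneg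
  set V' := V.map conjQ with hV'
  have hV'n : Module.finrank ℚ V' = n := by rw [hV', finrank_map_conjQ, hVn]
  have hδV' : δ V' = δ V := delta_map_conjQ V
  haveI : FiniteDimensional ℚ ↥(V ⊔ V') := Submodule.finiteDimensional_sup V V'
  haveI : FiniteDimensional ℚ ↥(V ⊓ V') := Submodule.finiteDimensional_of_le (inf_le_left : V ⊓ V' ≤ V)
  have hsub := delta_submod V V'
  have hdim := Submodule.finrank_sup_add_finrank_inf_eq V V'
  rw [hVn, hV'n] at hdim
  have hWσ : (V ⊔ V').map conjQ ≤ V ⊔ V' := by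
    rw [Submodule.map_sup, hV', map_conjQ_map_conjQ, sup_comm]
  by_cases hD : Module.finrank ℚ ↥(V ⊓ V') = n
  · -- `V` is `σ`-stable: `ConjSchanuelRank n` applies to `V` itself
    have hDV : V ⊓ V' = V := Submodule.eq_of_le_of_finrank_eq inf_le_left (by rw [hD, hVn])
    have hVσ : V.map conjQ ≤ V := by
      have h1 : V ≤ V' := by rw [← hDV]; exact inf_le_right
      have h2 := Submodule.map_mono (f := conjQ) h1
      rwa [hV', map_conjQ_map_conjQ] at h2
    have := (conjSchanuelRank_iff_delta n).1 hn V inferInstance hVn hVσ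
    exact absurd this (not_le.2 hneg)
  · -- `V ∩ σV` is proper: charged to the lower ranks; `V + σV` to a `σ`-stable hyperplane
    have hDlt : Module.finrank ℚ ↥(V ⊓ V') < n :=
      lt_of_le_of_ne (by rw [← hVn]; exact Submodule.finrank_mono inf_le_left) hD
    have hδD : 0 ≤ δ (V ⊓ V') := (schanuelRank_iff_delta _).1 (hlow _ hDlt) _ inferInstance rfl
    have hδW : δ (V ⊔ V') ≤ -2 := by linarith
    obtain ⟨N, hN⟩ : ∃ N, Module.finrank ℚ ↥(V ⊔ V') = N + 1 := ⟨Module.finrank ℚ ↥(V ⊔ V') - 1, by omega⟩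
    obtain ⟨P, hPW, hPσ, hPN⟩ := exists_conjStable_hyperplane (V ⊔ V') hWσ hN
    haveI : FiniteDimensional ℚ P := Submodule.finiteDimensional_of_le hPW
    have hConjN : ConjSchanuelRank N := by
      by_cases hNn : N = n
      · rw [hNn]; exact hn
      · exact hup N (by omega) (by omega)
    have hδP : 0 ≤ δ P := (conjSchanuelRank_iff_delta N).1 hConjN P inferInstance hPN hPσ
    have := delta_ge_of_codim_one hPW (by rw [hN, hPN])
    linarith

/-- The obliqueness is at most `n`: `dim (V + σV) ≤ 2n`. -/
theorem finrank_sup_conj_le {x : Fin n → ℂ} (hx : LinearIndependent ℚ x) :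
    Module.finrank ℚ ↥(Submodule.span ℚ (range x) ⊔ (Submodule.span ℚ (range x)).map conjQ) ≤ n + n := by
  haveI : FiniteDimensional ℚ ↥(Submodule.span ℚ (range x)) := FiniteDimensional.span_of_finite ℚ (finite_range x)
  refine (Submodule.finrank_add_le_finrank_add_finrank _ _).trans ?_
  rw [finrank_map_conjQ, finrank_span_eq_card hx, Fintype.card_fin]

/-- **Top rung**: `LowerRanks n` and `ConjSchanuelRank m` for `n ≤ m ≤ 2n − 1` give `SchanuelRank n`. -/
theorem schanuelRank_of_conj_window (hlow : ∀ m < n, SchanuelRank m)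
    (hwin : ∀ m, n ≤ m → m < n + n → ConjSchanuelRank m) : SchanuelRank n := by
  intro x hx
  rcases Nat.eq_zero_or_pos n with h0 | hpos
  · subst h0; simp
  exact ladder hlow (k := n) (hwin n le_rfl (by omega)) (fun m h1 h2 => hwin m h1.le h2) hx (finrank_sup_conj_le hx)

/-- **PADDING / the EQUIV layer**: Schanuel's conjecture is equivalent to its restriction to `σ`-stable tuples. -/
theorem schanuel_iff_conjSchanuel : _root_.Schanuel ↔ ∀ m, ConjSchanuelRank m := by
  constructor
  · exact fun h m => conjSchanuelRank_of_schanuelRank (h m)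
  · intro h
    show ∀ n, SchanuelRank n
    intro n
    induction n using Nat.strong_induction_on with
    | _ n ih => exact schanuelRank_of_conj_window ih (fun m _ _ => h m)

/-- Near-stability (`σ V ≤ V + ℚz`) means obliqueness `≤ 1`. -/
theorem finrank_sup_conj_le_succ_of_nearStable {x : Fin n → ℂ} (hx : LinearIndependent ℚ x)
    (hz : ∃ z : ℂ, ∀ j, (starRingEnd ℂ) (x j) ∈ Submodule.span ℚ (insert z (range x))) :
    Module.finrank ℚ ↥(Submodule.span ℚ (range x) ⊔ (Submodule.span ℚ (range x)).map conjQ) ≤ n + 1 := by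
  obtain ⟨z, hz⟩ := hz
  set V := Submodule.span ℚ (range x) with hV
  haveI : FiniteDimensional ℚ V := FiniteDimensional.span_of_finite ℚ (finite_range x)
  haveI : FiniteDimensional ℚ ↥(Submodule.span ℚ ({z} : Set ℂ)) := FiniteDimensional.span_of_finite ℚ (Set.finite_singleton z)
  have hVn : Module.finrank ℚ V = n := by rw [hV, finrank_span_eq_card hx, Fintype.card_fin]
  have hV'le : V.map conjQ ≤ V ⊔ Submodule.span ℚ {z} := by
    rw [hV, map_conjQ_span, Submodule.span_le]
    rintro _ ⟨j, rfl⟩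
    have := hz j
    rw [Set.insert_eq, Submodule.span_union] at this
    rw [sup_comm]; exact this
  have hWle : V ⊔ V.map conjQ ≤ V ⊔ Submodule.span ℚ {z} := sup_le le_sup_left hV'le
  refine (Submodule.finrank_mono hWle).trans ((Submodule.finrank_add_le_finrank_add_finrank _ _).trans ?_)
  rw [hVn]
  exact Nat.add_le_add_left ((finrank_span_le_card ({z} : Set ℂ)).trans (by simp)) n

/-- Conversely obliqueness `≤ 1` means near-stability. -/
theorem nearStable_of_finrank_sup_conj_le_succ {x : Fin n → ℂ} (hx : LinearIndependent ℚ x)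
    (h : Module.finrank ℚ ↥(Submodule.span ℚ (range x) ⊔ (Submodule.span ℚ (range x)).map conjQ) ≤ n + 1) :
    ∃ z : ℂ, ∀ j, (starRingEnd ℂ) (x j) ∈ Submodule.span ℚ (insert z (range x)) := by
  classical
  set V := Submodule.span ℚ (range x) with hV
  haveI : FiniteDimensional ℚ V := FiniteDimensional.span_of_finite ℚ (finite_range x)
  have hVn : Module.finrank ℚ V = n := by rw [hV, finrank_span_eq_card hx, Fintype.card_fin]
  have hxj : ∀ j, (starRingEnd ℂ) (x j) ∈ V.map conjQ := fun j =>
    ⟨x j, Submodule.subset_span ⟨j, rfl⟩, rfl⟩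
  by_cases hle : V.map conjQ ≤ V
  · exact ⟨0, fun j => Submodule.span_mono (Set.subset_insert _ _) (hle (hxj j))⟩
  · obtain ⟨w, hwV', hwV⟩ := Set.not_subset.1 hle
    refine ⟨w, fun j => ?_⟩
    rw [Set.insert_eq, Submodule.span_union, ← hV]
    -- `ℚw + V = V + σV` by a dimension count
    haveI : FiniteDimensional ℚ ↥(Submodule.span ℚ ({w} : Set ℂ)) := FiniteDimensional.span_of_finite ℚ (Set.finite_singleton w)
    have hsub : Submodule.span ℚ {w} ⊔ V ≤ V ⊔ V.map conjQ := by
      refine sup_le ?_ le_sup_left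
      rw [Submodule.span_le, Set.singleton_subset_iff]; exact le_sup_right (a := V) hwV'
    have hlt : V < Submodule.span ℚ {w} ⊔ V :=
      SetLike.lt_iff_le_and_exists.mpr ⟨le_sup_right, w, Submodule.mem_sup_left (Submodule.mem_span_singleton_self w), hwV⟩
    have h1 := Submodule.finrank_lt_finrank_of_lt hlt
    have heq : Submodule.span ℚ {w} ⊔ V = V ⊔ V.map conjQ :=
      Submodule.eq_of_le_of_finrank_le hsub (by rw [hVn] at h1; omega)
    rw [heq]
    exact le_sup_right (a := V) (hxj j)

/-- **THE SIBLING THEOREM `T₁` (first-failure form).**  Under the lower ranks, a rank-`n` counterexample whose span is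
NEARLY `σ`-stable (`σV ≤ V + ℚz`) yields a `σ`-STABLE rank-`n` counterexample (any `σ`-stable hyperplane of `V + σV`). -/
theorem conjStable_sibling (hlow : ∀ m < n, SchanuelRank m) {x : Fin n → ℂ} (hx : LinearIndependent ℚ x)
    (hlt : Algebra.trdeg ℚ ↥(IntermediateField.adjoin ℚ (range x ∪ range (cexp ∘ x))) < (n : Cardinal))
    (hz : ∃ z : ℂ, ∀ j, (starRingEnd ℂ) (x j) ∈ Submodule.span ℚ (insert z (range x))) :
    ∃ x' : Fin n → ℂ, (LinearIndependent ℚ x' ∧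
      Algebra.trdeg ℚ ↥(IntermediateField.adjoin ℚ (range x' ∪ range (cexp ∘ x'))) < (n : Cardinal)) ∧
      ∀ j, (starRingEnd ℂ) (x' j) ∈ Submodule.span ℚ (range x') := by
  classical
  have hob := finrank_sup_conj_le_succ_of_nearStable hx hz
  set V := Submodule.span ℚ (range x) with hV
  haveI : FiniteDimensional ℚ V := FiniteDimensional.span_of_finite ℚ (finite_range x)
  have hVn : Module.finrank ℚ V = n := by rw [hV, finrank_span_eq_card hx, Fintype.card_fin]
  have hδV : ¬ 0 ≤ δ V := fun h => absurd ((le_trdeg_iff_delta_nonneg hx).2 h) (not_le.2 hlt)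
  set V' := V.map conjQ with hV'
  have hV'n : Module.finrank ℚ V' = n := by rw [hV', finrank_map_conjQ, hVn]
  have hδV' : δ V' = δ V := delta_map_conjQ V
  haveI : FiniteDimensional ℚ ↥(V ⊔ V') := Submodule.finiteDimensional_sup V V'
  haveI : FiniteDimensional ℚ ↥(V ⊓ V') := Submodule.finiteDimensional_of_le (inf_le_left : V ⊓ V' ≤ V)
  have hsub := delta_submod V V'
  have hdim := Submodule.finrank_sup_add_finrank_inf_eq V V'
  rw [hVn, hV'n] at hdim
  have hWσ : (V ⊔ V').map conjQ ≤ V ⊔ V' := by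
    rw [Submodule.map_sup, hV', map_conjQ_map_conjQ, sup_comm]
  by_cases hD : Module.finrank ℚ ↥(V ⊓ V') = n
  · -- `x` itself is `σ`-stable
    have hDV : V ⊓ V' = V := Submodule.eq_of_le_of_finrank_eq inf_le_left (by rw [hD, hVn])
    have hVσ : V.map conjQ ≤ V := by
      have h1 : V ≤ V' := by rw [← hDV]; exact inf_le_right
      have h2 := Submodule.map_mono (f := conjQ) h1
      rwa [hV', map_conjQ_map_conjQ] at h2
    exact ⟨x, ⟨hx, hlt⟩, (map_conjQ_span_le_iff x).1 hVσ⟩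
  · have hDlt : Module.finrank ℚ ↥(V ⊓ V') < n :=
      lt_of_le_of_ne (by rw [← hVn]; exact Submodule.finrank_mono inf_le_left) hD
    have hδD : 0 ≤ δ (V ⊓ V') := (schanuelRank_iff_delta _).1 (hlow _ hDlt) _ inferInstance rfl
    have hδW : δ (V ⊔ V') ≤ -2 := by push Not at hδV; linarith
    have hWn : Module.finrank ℚ ↥(V ⊔ V') = n + 1 := by
      have : Module.finrank ℚ ↥(V ⊔ V') ≤ n + 1 := hob
      omega
    obtain ⟨P, hPW, hPσ, hPN⟩ := exists_conjStable_hyperplane (V ⊔ V') hWσ hWn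
    haveI : FiniteDimensional ℚ P := Submodule.finiteDimensional_of_le hPW
    have hδP : ¬ 0 ≤ δ P := by
      have := delta_ge_of_codim_one hPW (by rw [hWn, hPN]); intro h; linarith
    obtain ⟨x', hx', rfl⟩ := exists_basis_tuple P hPN
    refine ⟨x', ⟨hx', ?_⟩, (map_conjQ_span_le_iff x').1 hPσ⟩
    exact not_le.1 (fun h => hδP ((le_trdeg_iff_delta_nonneg hx').1 h))


/-! ## §4 Unconditional rungs at rank two (Hermite–Lindemann pays the lower ranks) -/

/-- (private: print-twin of a landed declaration, gate dedup) Rank `0` is trivial. -/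
private theorem schanuelRank_zero : SchanuelRank 0 := fun y _ => by simp

/-- (private: print-twin of a landed declaration, gate dedup) Rank `1` is Hermite–Lindemann (tree theorem `transcendental_exp_holds`). -/
private theorem schanuelRank_one : SchanuelRank 1 :=
  Literature.Transcend.schanuelRank_one_of_transcendental_exp Literature.NumberTheory.Transcendental.transcendental_exp_holds

/-- Schanuel holds below rank `2` unconditionally. -/
theorem lowerRanks_two : ∀ m < 2, SchanuelRank m := by
  intro m hm
  interval_cases m
  · exact schanuelRank_zero
  · exact schanuelRank_one

/-- **Rank two, unconditionally**: Schanuel at the `σ`-STABLE `ℚ`-free pairs (both coordinates real, or purely imaginary,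
or one of each, or a conjugate pair `(w, w̄)` up to span) implies Schanuel at every `ℚ`-free pair whose span contains a
nonzero real or purely imaginary number — e.g. `(1, w)`, `(iπ, w)`, `(log 2, w)` for arbitrary `w`. -/
theorem pair_of_conjStable_pairs (h : ConjSchanuelRank 2) (x : Fin 2 → ℂ) (hx : LinearIndependent ℚ x)
    (hz : ∃ z : ℂ, ∀ j, (starRingEnd ℂ) (x j) ∈ Submodule.span ℚ (insert z (range x))) :
    (2 : Cardinal) ≤ Algebra.trdeg ℚ ↥(IntermediateField.adjoin ℚ (range x ∪ range (cexp ∘ x))) := by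
  have := ladder (n := 2) lowerRanks_two (k := 1) h (fun m h1 h2 => by omega) hx
    (finrank_sup_conj_le_succ_of_nearStable hx hz)
  exact_mod_cast this

/-- … and a rank-two counterexample with a real (or imaginary) vector in its span has a `σ`-stable sibling counterexample,
unconditionally. -/
theorem pair_sibling (x : Fin 2 → ℂ) (hx : LinearIndependent ℚ x)
    (hlt : Algebra.trdeg ℚ ↥(IntermediateField.adjoin ℚ (range x ∪ range (cexp ∘ x))) < (2 : Cardinal))
    (hz : ∃ z : ℂ, ∀ j, (starRingEnd ℂ) (x j) ∈ Submodule.span ℚ (insert z (range x))) :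
    ∃ x' : Fin 2 → ℂ, (LinearIndependent ℚ x' ∧
      Algebra.trdeg ℚ ↥(IntermediateField.adjoin ℚ (range x' ∪ range (cexp ∘ x'))) < (2 : Cardinal)) ∧
      ∀ j, (starRingEnd ℂ) (x' j) ∈ Submodule.span ℚ (range x') := by
  have := conjStable_sibling (n := 2) lowerRanks_two hx (by exact_mod_cast hlt) hz
  exact_mod_cast this

end Summit.Schanuel.Schanuel.Theorems.RootDecomp1HMirror
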